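import Mathlib
import Summits.RiemannHypothesis.RiemannHypothesis.Theorems.WeilFarCoercivityFloor
import Literature.NumberTheory.LFunctions.ChebyshevPsiExplicit
import Literature.NumberTheory.LFunctions.MertensFirstVonMangoldtUpper
import HarnessLib

/-!
# The far-coercivity floor against `ψ` and Mertens' `M`: the Schur test, and the floor's exponential order from ABOVE

Helper file (`--supports stmt-RiemannHypothesis-0098`, lead-track anchor: Weil-positivity window ladder, format-C far bound),
RH-free, pure proofs.  Seat rh-explicit-weil-1 gen9 (memo `run/shared/lean/pub/rh-explicit/rh-explicit-weil-1/FORMAT-K3.md` §10).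
Companion of `WeilFarCoercivityFloor` (floor `λ_max(a)`, law C-XIII `λ_max(a) = L(a) − 2γ_E + ε(a)`), `WeilFarFloorGrowth`
(`0.7e^a/a − 6 ≤ λ_max(a)`) and `WeilFarFloorOrder` (`λ_max(a) ≤ 38(e^a + 1)`); this file replaces the `38` by Chebyshev's `1.1056`.
§1 SCHUR TEST.  The kernel of `Q_a` is a nonnegative measure, so for ANY weight `w`, positive and bounded on `[−a, a]`, weighted
AM–GM shift by shift gives `Σ_{n<N} 2Λ(n)/√n ∫ f(x − log n) f(x) ≤ B·∫f²` as soon as `(T_N w)(x) ≤ B·w(x)` on `[−a, a]`,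
`(T_N w)(x) = Σ_{n<N} Λ(n)/√n·(χ(x − log n) + χ(x + log n))`, `χ = 1_{[−a,a]}·w` (`shiftBound_range_of_schur`): a LINEAR
(Collatz–Wielandt) certificate for the far constant, no sum of squares.
§2 THE WEIGHT `cosh(x/2)` collapses the Schur sum onto the Chebyshev functions (`Λ(n)/√n·cosh((x ∓ log n)/2) = ½Λ(n)(e^{±x/2}/n + e^{∓x/2})`):
`(T w)(x) ≤ ½[e^{x/2}(M(e^{a+x}) + ψ(e^{a−x})) + e^{−x/2}(ψ(e^{a+x}) + M(e^{a−x}))]`, `M(X) = Σ_{n≤X} Λ(n)/n` (`schurSum_cosh_le`).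
§3 ORDER FROM ABOVE.  With Chebyshev's `ψ(x) ≤ (6A/5)x + 3 log²x + 80` (`6A/5 < 1.1056`, Literature `ChebyshevExplicit`) and
`M(x) ≤ log x + 39/50` (Literature `MertensFirstUpper`): **`λ_max(a) ≤ (1106/1000)e^a + 12a² + 2a + 4039/50` for every `a > 0`**
(`farCoercivityFloor_le_chebyshev`; shift-bound form for every `N`, `shiftBound_range_chebyshev`), i.e. `limsup λ_max(a)e^{−a} ≤ 1.1056`
by theorem (law: `1`); §2 shows that `ψ(x) ≤ (1 + η)x + o(x)` is exactly what makes the constant `1 + η`.  Exact Schur values of §2: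
`2.76 / 5.68 / 9.56 / 24.4` at `a = 1 / 1.5 / 2 / 3` (float floor `1.95 / 4.29 / 7.97 / 22.5`).  Standard axioms only.
-/

set_option linter.dupNamespace false
set_option autoImplicit false

noncomputable section

open MeasureTheory Set Finset
open scoped Real BigOperators ArithmeticFunction.vonMangoldt Chebyshev

namespace Summit.RiemannHypothesis.RiemannHypothesis.Theorems.WeilFormatC

namespace FloorSchur

variable {a : ℝ}

/-! ## §1 The Schur test for the prime-shift form -/

/-- Weighted AM–GM: `2uv ≤ u²·t + v²/t` for `t > 0`. -/
theorem two_mul_le_of_pos {u v t : ℝ} (ht : 0 < t) : 2 * (u * v) ≤ u ^ 2 * t + v ^ 2 / t := by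
  rw [← sub_nonneg, show u ^ 2 * t + v ^ 2 / t - 2 * (u * v) = (u * t - v) ^ 2 / t by field_simp; ring]
  positivity

/-- Pointwise Schur inequality for one shift `ℓ` and a weight `w` positive on `[−a, a]`; with `χ = 1_{[−a,a]}·w`:
`2 f(x−ℓ) f(x) ≤ f(x−ℓ)²·χ(x)/w(x−ℓ) + f(x)²·χ(x−ℓ)/w(x)` (both sides vanish unless `x, x − ℓ ∈ [−a, a]`). -/
theorem pointwise_schur {f w : ℝ → ℝ} {c : ℝ} (hc : 0 < c) (hcw : ∀ x ∈ Icc (-a) a, c ≤ w x)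
    (hsupp : ∀ x, x ∉ Icc (-a) a → f x = 0) (ℓ x : ℝ) :
    2 * (f (x - ℓ) * f x) ≤ f (x - ℓ) ^ 2 * ((Icc (-a) a).indicator w x / w (x - ℓ))
      + f x ^ 2 * ((Icc (-a) a).indicator w (x - ℓ) / w x) := by
  by_cases hx : x ∈ Icc (-a) a
  · by_cases hxl : x - ℓ ∈ Icc (-a) a
    · rw [indicator_of_mem hx, indicator_of_mem hxl]
      have hwx : 0 < w x := hc.trans_le (hcw x hx)
      have hwl : 0 < w (x - ℓ) := hc.trans_le (hcw _ hxl)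
      have h := two_mul_le_of_pos (u := f (x - ℓ)) (v := f x) (div_pos hwx hwl)
      calc 2 * (f (x - ℓ) * f x) ≤ f (x - ℓ) ^ 2 * (w x / w (x - ℓ)) + f x ^ 2 / (w x / w (x - ℓ)) := h
        _ = _ := by rw [div_div_eq_mul_div, mul_div_assoc]
    · rw [hsupp _ hxl, indicator_of_notMem hxl]
      simp
  · rw [hsupp _ hx, indicator_of_notMem hx]
    simp

/-- Integrability of the Schur majorants `f(x−u)²·χ(x−v)/w(x−u)` (bounded by `C²·|C_w|/c`, supported in `[−a+u, a+u]`). -/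
theorem integrable_sq_mul_ratio {f w : ℝ → ℝ} (hf : Measurable f) (hw : Measurable w) {C c Cw : ℝ}
    (hC : ∀ x, |f x| ≤ C) (hsupp : ∀ x, x ∉ Icc (-a) a → f x = 0) (hc : 0 < c)
    (hcw : ∀ x ∈ Icc (-a) a, c ≤ w x) (hwC : ∀ x ∈ Icc (-a) a, w x ≤ Cw) (u v : ℝ) :
    Integrable (fun x ↦ f (x - u) ^ 2 * ((Icc (-a) a).indicator w (x - v) / w (x - u))) := by
  set I := Icc (-a) a with hI
  have hmeas : Measurable fun x ↦ f (x - u) ^ 2 * (I.indicator w (x - v) / w (x - u)) :=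
    ((hf.comp (measurable_id.sub_const u)).pow_const 2).mul
      (((hw.indicator measurableSet_Icc).comp (measurable_id.sub_const v)).div
        (hw.comp (measurable_id.sub_const u)))
  have hvol : volume (Icc (-a + u) (a + u)) ≠ ⊤ := by
    rw [Real.volume_Icc]; exact ENNReal.ofReal_ne_top
  have hg : Integrable ((Icc (-a + u) (a + u)).indicator fun _ : ℝ ↦ C ^ 2 * (|Cw| / c)) :=
    (integrable_indicator_iff measurableSet_Icc).2 (integrableOn_const hvol)
  refine Integrable.mono' hg hmeas.aestronglyMeasurable (Filter.Eventually.of_forall fun x ↦ ?_)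
  by_cases hx : x ∈ Icc (-a + u) (a + u)
  · rw [Set.indicator_of_mem hx, Real.norm_eq_abs, abs_mul]
    have hxu : x - u ∈ I := ⟨by linarith [hx.1], by linarith [hx.2]⟩
    have hf2 : |f (x - u) ^ 2| ≤ C ^ 2 := by
      rw [abs_pow]
      exact pow_le_pow_left₀ (abs_nonneg _) (hC _) 2
    have hχ : |I.indicator w (x - v)| ≤ |Cw| := by
      by_cases hxv : x - v ∈ I
      · rw [indicator_of_mem hxv]
        have h1 : c ≤ w (x - v) := hcw _ hxv
        rw [abs_of_pos (hc.trans_le h1)]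
        exact (hwC _ hxv).trans (le_abs_self _)
      · rw [indicator_of_notMem hxv, abs_zero]; exact abs_nonneg _
    have hwpos : 0 < w (x - u) := hc.trans_le (hcw _ hxu)
    have hrat : |I.indicator w (x - v) / w (x - u)| ≤ |Cw| / c := by
      rw [abs_div, abs_of_pos hwpos]
      exact div_le_div₀ (abs_nonneg _) hχ hc (hcw _ hxu)
    exact mul_le_mul hf2 hrat (abs_nonneg _) (sq_nonneg _)
  · have hxu : x - u ∉ I := fun h ↦ hx ⟨by linarith [h.1], by linarith [h.2]⟩
    rw [Set.indicator_of_notMem hx, hsupp _ hxu]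
    simp

/-- **The Schur test for the prime-shift form.**  If a measurable weight `w`, bounded between two positive constants on
`[−a, a]`, satisfies `(T_N w)(x) ≤ B·w(x)` on `[−a, a]`, where
`(T_N w)(x) = Σ_{n<N} Λ(n)/√n · (χ(x − log n) + χ(x + log n))`, `χ = 1_{[−a,a]}·w`, then
`Σ_{n<N} 2Λ(n)/√n ∫ f(x − log n) f(x) dx ≤ B · ∫ f²` for every real measurable bounded `f` vanishing off `[−a, a]`. -/
theorem shiftBound_range_of_schur {N : ℕ} {w : ℝ → ℝ} (hw : Measurable w) {c Cw B : ℝ} (hc : 0 < c)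
    (hcw : ∀ x ∈ Icc (-a) a, c ≤ w x) (hwC : ∀ x ∈ Icc (-a) a, w x ≤ Cw)
    (hB : ∀ x ∈ Icc (-a) a, ∑ n ∈ Finset.range N, ((Λ n : ℝ) / Real.sqrt n) *
        ((Icc (-a) a).indicator w (x - Real.log n) + (Icc (-a) a).indicator w (x + Real.log n)) ≤ B * w x)
    {f : ℝ → ℝ} {C : ℝ} (hf : Measurable f) (hC : ∀ x, |f x| ≤ C) (hsupp : ∀ x, x ∉ Icc (-a) a → f x = 0) :
    ∑ n ∈ Finset.range N, 2 * ((Λ n : ℝ) / Real.sqrt n) * (∫ x, f (x - Real.log n) * f x)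
      ≤ B * ∫ x, f x ^ 2 := by
  set I := Icc (-a) a with hI
  set χ := I.indicator w with hχ
  have hI2 : ∀ ℓ : ℝ, Integrable (fun x ↦ f x ^ 2 * (χ (x - ℓ) / w x)) := fun ℓ ↦ by
    simpa using integrable_sq_mul_ratio hf hw hC hsupp hc hcw hwC 0 ℓ
  have hI3 : ∀ ℓ : ℝ, Integrable (fun x ↦ f x ^ 2 * (χ (x + ℓ) / w x)) := fun ℓ ↦ by
    simpa [sub_neg_eq_add] using integrable_sq_mul_ratio hf hw hC hsupp hc hcw hwC 0 (-ℓ)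
  have hsq : Integrable (fun x ↦ f x ^ 2) :=
    (integrable_shift_mul_shift hf hC hsupp 0 0).congr
      (Filter.Eventually.of_forall fun x ↦ by simp only [sub_zero, pow_two])
  have hstep : ∀ ℓ : ℝ, 2 * (∫ x, f (x - ℓ) * f x) ≤ ∫ x, f x ^ 2 * ((χ (x - ℓ) + χ (x + ℓ)) / w x) := by
    intro ℓ
    have h1 : Integrable (fun x ↦ f (x - ℓ) ^ 2 * (χ x / w (x - ℓ))) := by
      simpa using integrable_sq_mul_ratio hf hw hC hsupp hc hcw hwC ℓ 0
    have hm : Integrable (fun x ↦ f (x - ℓ) * f x) :=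
      (integrable_shift_mul_shift hf hC hsupp ℓ 0).congr
        (Filter.Eventually.of_forall fun x ↦ by simp only [sub_zero])
    have htr : (∫ x, f (x - ℓ) ^ 2 * (χ x / w (x - ℓ))) = ∫ x, f x ^ 2 * (χ (x + ℓ) / w x) := by
      simpa only [sub_add_cancel] using integral_sub_right_eq_self (μ := volume) (fun y ↦ f y ^ 2 * (χ (y + ℓ) / w y)) ℓ
    calc 2 * (∫ x, f (x - ℓ) * f x) = ∫ x, 2 * (f (x - ℓ) * f x) := (integral_const_mul _ _).symm
      _ ≤ ∫ x, (f (x - ℓ) ^ 2 * (χ x / w (x - ℓ)) + f x ^ 2 * (χ (x - ℓ) / w x)) :=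
          integral_mono (hm.const_mul 2) (h1.add (hI2 ℓ)) fun x ↦ pointwise_schur hc hcw hsupp ℓ x
      _ = (∫ x, f (x - ℓ) ^ 2 * (χ x / w (x - ℓ))) + ∫ x, f x ^ 2 * (χ (x - ℓ) / w x) :=
          integral_add h1 (hI2 ℓ)
      _ = (∫ x, f x ^ 2 * (χ (x + ℓ) / w x)) + ∫ x, f x ^ 2 * (χ (x - ℓ) / w x) := by rw [htr]
      _ = ∫ x, f x ^ 2 * ((χ (x - ℓ) + χ (x + ℓ)) / w x) := by
          rw [← integral_add (hI3 ℓ) (hI2 ℓ)]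
          refine integral_congr_ae (Filter.Eventually.of_forall fun x ↦ ?_)
          simp only
          ring
  have hwt : ∀ n : ℕ, 0 ≤ (Λ n : ℝ) / Real.sqrt n := fun n ↦
    div_nonneg ArithmeticFunction.vonMangoldt_nonneg (Real.sqrt_nonneg _)
  have hsum : ∑ n ∈ Finset.range N, 2 * ((Λ n : ℝ) / Real.sqrt n) * (∫ x, f (x - Real.log n) * f x)
      ≤ ∑ n ∈ Finset.range N, ((Λ n : ℝ) / Real.sqrt n) *
          ∫ x, f x ^ 2 * ((χ (x - Real.log n) + χ (x + Real.log n)) / w x) := by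
    refine Finset.sum_le_sum fun n _ ↦ ?_
    nlinarith [hstep (Real.log n), hwt n]
  refine hsum.trans ?_
  have hIn : ∀ n : ℕ, Integrable (fun x ↦ ((Λ n : ℝ) / Real.sqrt n) *
      (f x ^ 2 * ((χ (x - Real.log n) + χ (x + Real.log n)) / w x))) := fun n ↦ by
    have h := ((hI2 (Real.log n)).add (hI3 (Real.log n))).const_mul ((Λ n : ℝ) / Real.sqrt n)
    refine h.congr (Filter.Eventually.of_forall fun x ↦ ?_)
    simp only [Pi.add_apply]
    ring
  rw [show (∑ n ∈ Finset.range N, ((Λ n : ℝ) / Real.sqrt n) *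
          ∫ x, f x ^ 2 * ((χ (x - Real.log n) + χ (x + Real.log n)) / w x))
        = ∫ x, ∑ n ∈ Finset.range N, ((Λ n : ℝ) / Real.sqrt n) *
          (f x ^ 2 * ((χ (x - Real.log n) + χ (x + Real.log n)) / w x)) by
      rw [integral_finsetSum _ fun n _ ↦ hIn n]
      refine Finset.sum_congr rfl fun n _ ↦ ?_
      rw [integral_const_mul]]
  rw [← integral_const_mul]
  refine integral_mono (integrable_finsetSum _ fun n _ ↦ hIn n) (hsq.const_mul B) fun x ↦ ?_
  simp only
  by_cases hx : x ∈ I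
  · have hwx : 0 < w x := hc.trans_le (hcw x hx)
    have hTB := hB x hx
    have hrw : ∑ n ∈ Finset.range N, ((Λ n : ℝ) / Real.sqrt n) *
        (f x ^ 2 * ((χ (x - Real.log n) + χ (x + Real.log n)) / w x))
        = (f x ^ 2 / w x) * ∑ n ∈ Finset.range N, ((Λ n : ℝ) / Real.sqrt n) *
            (χ (x - Real.log n) + χ (x + Real.log n)) := by
      rw [Finset.mul_sum]
      refine Finset.sum_congr rfl fun n _ ↦ ?_
      field_simp
    rw [hrw]
    calc f x ^ 2 / w x * ∑ n ∈ Finset.range N, ((Λ n : ℝ) / Real.sqrt n) *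
            (χ (x - Real.log n) + χ (x + Real.log n))
        ≤ f x ^ 2 / w x * (B * w x) :=
          mul_le_mul_of_nonneg_left hTB (div_nonneg (sq_nonneg _) hwx.le)
      _ = B * f x ^ 2 := by field_simp
  · rw [hsupp x hx]
    simp

/-! ## §2 The weight `cosh(x/2)`: the Schur sum in terms of `ψ` and `M(X) = Σ_{n≤X} Λ(n)/n` -/

/-- `Λ(n)/√n · cosh((x − log n)/2) = ½·Λ(n)·(e^{x/2}/n + e^{−x/2})` for `n ≥ 1`. -/
theorem weight_term_sub {n : ℕ} (hn : 1 ≤ n) (x : ℝ) :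
    ((Λ n : ℝ) / Real.sqrt n) * Real.cosh ((x - Real.log n) / 2)
      = (Λ n : ℝ) / 2 * (Real.exp (x / 2) / n + Real.exp (-(x / 2))) := by
  have hn0 : (0 : ℝ) < n := by exact_mod_cast hn
  set s := Real.sqrt (n : ℝ) with hs
  have hs0 : 0 < s := Real.sqrt_pos.2 hn0
  have hss : s * s = n := Real.mul_self_sqrt hn0.le
  have hlog : Real.log n = 2 * Real.log s := by
    rw [← hss, Real.log_mul hs0.ne' hs0.ne']; ring
  have h1 : Real.exp ((x - Real.log n) / 2) = Real.exp (x / 2) / s := by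
    rw [hlog, show (x - 2 * Real.log s) / 2 = x / 2 - Real.log s by ring, Real.exp_sub, Real.exp_log hs0]
  have h2 : Real.exp (-((x - Real.log n) / 2)) = s * Real.exp (-(x / 2)) := by
    rw [hlog, show -((x - 2 * Real.log s) / 2) = Real.log s + -(x / 2) by ring, Real.exp_add, Real.exp_log hs0]
  rw [Real.cosh_eq, h1, h2, ← hss]
  field_simp

/-- `Λ(n)/√n · cosh((x + log n)/2) = ½·Λ(n)·(e^{x/2} + e^{−x/2}/n)` for `n ≥ 1`. -/
theorem weight_term_add {n : ℕ} (hn : 1 ≤ n) (x : ℝ) :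
    ((Λ n : ℝ) / Real.sqrt n) * Real.cosh ((x + Real.log n) / 2)
      = (Λ n : ℝ) / 2 * (Real.exp (x / 2) + Real.exp (-(x / 2)) / n) := by
  have h := weight_term_sub hn (-x)
  rw [show (-x - Real.log n) / 2 = -((x + Real.log n) / 2) by ring, Real.cosh_neg] at h
  rw [h, show -x / 2 = -(x / 2) by ring, neg_neg]
  ring

/-- For `n ≥ 1` and `x ∈ [−a, a]`: `x − log n ∈ [−a, a] ↔ n ≤ ⌊e^{a+x}⌋`. -/
theorem sub_log_mem_Icc_iff {n : ℕ} (hn : 1 ≤ n) {x : ℝ} (hx : x ∈ Icc (-a) a) :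
    x - Real.log n ∈ Icc (-a) a ↔ n ≤ ⌊Real.exp (a + x)⌋₊ := by
  have hn0 : (0 : ℝ) < n := by exact_mod_cast hn
  have hlog : 0 ≤ Real.log n := Real.log_nonneg (by exact_mod_cast hn)
  rw [Nat.le_floor_iff (Real.exp_pos _).le, ← Real.log_le_iff_le_exp hn0, Set.mem_Icc]
  constructor
  · rintro ⟨h1, -⟩; linarith
  · intro h; exact ⟨by linarith, by linarith [hx.2]⟩

/-- For `n ≥ 1` and `x ∈ [−a, a]`: `x + log n ∈ [−a, a] ↔ n ≤ ⌊e^{a−x}⌋`. -/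
theorem add_log_mem_Icc_iff {n : ℕ} (hn : 1 ≤ n) {x : ℝ} (hx : x ∈ Icc (-a) a) :
    x + Real.log n ∈ Icc (-a) a ↔ n ≤ ⌊Real.exp (a - x)⌋₊ := by
  have hn0 : (0 : ℝ) < n := by exact_mod_cast hn
  have hlog : 0 ≤ Real.log n := Real.log_nonneg (by exact_mod_cast hn)
  rw [Nat.le_floor_iff (Real.exp_pos _).le, ← Real.log_le_iff_le_exp hn0, Set.mem_Icc]
  constructor
  · rintro ⟨-, h2⟩; linarith
  · intro h; exact ⟨by linarith [hx.1], by linarith⟩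

/-- Truncated nonnegative sums: if `t(n) = [n ∈ (0, X]]·g(n)` with `g ≥ 0` on `(0, X]`, then `Σ_{n∈s} t(n) ≤ Σ_{0<n≤X} g(n)`. -/
theorem sum_trunc_le {s : Finset ℕ} {X : ℕ} {t g : ℕ → ℝ}
    (ht : ∀ n, t n = if n ∈ Finset.Ioc 0 X then g n else 0) (hg : ∀ n ∈ Finset.Ioc 0 X, 0 ≤ g n) :
    ∑ n ∈ s, t n ≤ ∑ n ∈ Finset.Ioc 0 X, g n := by
  simp_rw [ht]
  rw [← Finset.sum_filter]
  exact Finset.sum_le_sum_of_subset_of_nonneg (fun n hn ↦ (Finset.mem_filter.1 hn).2)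
    fun n hn _ ↦ hg n hn

/-- **The Schur sum of the weight `cosh(x/2)` collapses onto `ψ` and `M`**: for `x ∈ [−a, a]` and any finite set of shifts,
`Σ_n Λ(n)/√n·(χ(x − log n) + χ(x + log n)) ≤ ½·[e^{x/2}(M(e^{a+x}) + ψ(e^{a−x})) + e^{−x/2}(ψ(e^{a+x}) + M(e^{a−x}))]`,
`χ = 1_{[−a,a]}·cosh(·/2)`, `M(X) = Σ_{0<n≤X} Λ(n)/n` (equality when the set contains `(0, e^{2a}]`). -/
theorem schurSum_cosh_le {x : ℝ} (hx : x ∈ Icc (-a) a) (s : Finset ℕ) :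
    ∑ n ∈ s, ((Λ n : ℝ) / Real.sqrt n) *
        ((Icc (-a) a).indicator (fun y ↦ Real.cosh (y / 2)) (x - Real.log n)
          + (Icc (-a) a).indicator (fun y ↦ Real.cosh (y / 2)) (x + Real.log n))
      ≤ (Real.exp (x / 2) * ((∑ n ∈ Finset.Ioc 0 ⌊Real.exp (a + x)⌋₊, (Λ n : ℝ) / n) + ψ (Real.exp (a - x)))
          + Real.exp (-(x / 2)) * (ψ (Real.exp (a + x)) + ∑ n ∈ Finset.Ioc 0 ⌊Real.exp (a - x)⌋₊, (Λ n : ℝ) / n)) / 2 := by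
  set I := Icc (-a) a with hI
  set Xp := ⌊Real.exp (a + x)⌋₊ with hXp
  set Xm := ⌊Real.exp (a - x)⌋₊ with hXm
  have hsub : ∑ n ∈ s, ((Λ n : ℝ) / Real.sqrt n) * I.indicator (fun y ↦ Real.cosh (y / 2)) (x - Real.log n)
      ≤ ∑ n ∈ Finset.Ioc 0 Xp, (Λ n : ℝ) / 2 * (Real.exp (x / 2) / n + Real.exp (-(x / 2))) := by
    refine sum_trunc_le (fun n ↦ ?_) fun n _ ↦ by positivity [ArithmeticFunction.vonMangoldt_nonneg (n := n)]
    rcases Nat.eq_zero_or_pos n with rfl | hn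
    · simp
    · have hn1 : 1 ≤ n := hn
      have hmem : n ∈ Finset.Ioc 0 Xp ↔ x - Real.log n ∈ I := by
        rw [Finset.mem_Ioc, sub_log_mem_Icc_iff hn1 hx]; omega
      by_cases h : x - Real.log n ∈ I
      · rw [indicator_of_mem h, if_pos (hmem.2 h), weight_term_sub hn1]
      · rw [indicator_of_notMem h, if_neg (fun h' ↦ h (hmem.1 h')), mul_zero]
  have hadd : ∑ n ∈ s, ((Λ n : ℝ) / Real.sqrt n) * I.indicator (fun y ↦ Real.cosh (y / 2)) (x + Real.log n)
      ≤ ∑ n ∈ Finset.Ioc 0 Xm, (Λ n : ℝ) / 2 * (Real.exp (x / 2) + Real.exp (-(x / 2)) / n) := by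
    refine sum_trunc_le (fun n ↦ ?_) fun n _ ↦ by positivity [ArithmeticFunction.vonMangoldt_nonneg (n := n)]
    rcases Nat.eq_zero_or_pos n with rfl | hn
    · simp
    · have hn1 : 1 ≤ n := hn
      have hmem : n ∈ Finset.Ioc 0 Xm ↔ x + Real.log n ∈ I := by
        rw [Finset.mem_Ioc, add_log_mem_Icc_iff hn1 hx]; omega
      by_cases h : x + Real.log n ∈ I
      · rw [indicator_of_mem h, if_pos (hmem.2 h), weight_term_add hn1]
      · rw [indicator_of_notMem h, if_neg (fun h' ↦ h (hmem.1 h')), mul_zero]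
  have hψp : ψ (Real.exp (a + x)) = ∑ n ∈ Finset.Ioc 0 Xp, (Λ n : ℝ) := rfl
  have hψm : ψ (Real.exp (a - x)) = ∑ n ∈ Finset.Ioc 0 Xm, (Λ n : ℝ) := rfl
  have hR1 : ∑ n ∈ Finset.Ioc 0 Xp, (Λ n : ℝ) / 2 * (Real.exp (x / 2) / n + Real.exp (-(x / 2)))
      = (Real.exp (x / 2) * (∑ n ∈ Finset.Ioc 0 Xp, (Λ n : ℝ) / n)
          + Real.exp (-(x / 2)) * ∑ n ∈ Finset.Ioc 0 Xp, (Λ n : ℝ)) / 2 := by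
    rw [Finset.mul_sum, Finset.mul_sum, ← Finset.sum_add_distrib, Finset.sum_div]
    refine Finset.sum_congr rfl fun n _ ↦ ?_
    ring
  have hR2 : ∑ n ∈ Finset.Ioc 0 Xm, (Λ n : ℝ) / 2 * (Real.exp (x / 2) + Real.exp (-(x / 2)) / n)
      = (Real.exp (x / 2) * (∑ n ∈ Finset.Ioc 0 Xm, (Λ n : ℝ))
          + Real.exp (-(x / 2)) * ∑ n ∈ Finset.Ioc 0 Xm, (Λ n : ℝ) / n) / 2 := by
    rw [Finset.mul_sum, Finset.mul_sum, ← Finset.sum_add_distrib, Finset.sum_div]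
    refine Finset.sum_congr rfl fun n _ ↦ ?_
    ring
  calc ∑ n ∈ s, ((Λ n : ℝ) / Real.sqrt n) *
        (I.indicator (fun y ↦ Real.cosh (y / 2)) (x - Real.log n)
          + I.indicator (fun y ↦ Real.cosh (y / 2)) (x + Real.log n))
      = (∑ n ∈ s, ((Λ n : ℝ) / Real.sqrt n) * I.indicator (fun y ↦ Real.cosh (y / 2)) (x - Real.log n))
        + ∑ n ∈ s, ((Λ n : ℝ) / Real.sqrt n) * I.indicator (fun y ↦ Real.cosh (y / 2)) (x + Real.log n) := by
        rw [← Finset.sum_add_distrib]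
        refine Finset.sum_congr rfl fun n _ ↦ ?_
        ring
    _ ≤ _ := add_le_add hsub hadd
    _ = _ := by rw [hR1, hR2, hψp, hψm]; ring

/-! ## §3 The floor's exponential order from above -/

/-- Chebyshev's explicit bound in real form (Literature `ChebyshevExplicit.psi_le_chebyshev`, `6A/5 < 1.1056`):
`ψ(X) ≤ (1106/1000)·X + 3·log² X + 80` for real `X ≥ 1`. -/
theorem psi_le_cheb {X : ℝ} (hX : 1 ≤ X) : ψ X ≤ 1106 / 1000 * X + 3 * Real.log X ^ 2 + 80 := by
  have hA := Literature.NumberTheory.LFunctions.ChebyshevExplicit.A_bounds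
  have h := Literature.NumberTheory.LFunctions.ChebyshevExplicit.psi_le_chebyshev ⌊X⌋₊
  rw [Chebyshev.psi_eq_psi_coe_floor X]
  have hfl1 : (1 : ℝ) ≤ (⌊X⌋₊ : ℝ) := by exact_mod_cast Nat.le_floor (by exact_mod_cast hX)
  have hflX : (⌊X⌋₊ : ℝ) ≤ X := Nat.floor_le (by linarith)
  have hlog : Real.log (⌊X⌋₊ : ℝ) ≤ Real.log X := Real.log_le_log (by linarith) hflX
  have hlog0 : 0 ≤ Real.log (⌊X⌋₊ : ℝ) := Real.log_nonneg hfl1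
  have hsq : Real.log (⌊X⌋₊ : ℝ) ^ 2 ≤ Real.log X ^ 2 := pow_le_pow_left₀ hlog0 hlog 2
  have hmain : 6 / 5 * Literature.NumberTheory.LFunctions.ChebyshevExplicit.A * (⌊X⌋₊ : ℝ) ≤ 1106 / 1000 * X :=
    (mul_le_mul_of_nonneg_right (by linarith [hA.2]) (by linarith)).trans (mul_le_mul_of_nonneg_left hflX (by norm_num))
  linarith

/-- The odd part of the Schur sum is dominated by the even part: for `x ∈ [−a, a]`,
`e^{x/2}((a + x) + K) + e^{−x/2}((a − x) + K) ≤ (2a + K)(e^{x/2} + e^{−x/2})`. -/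
theorem linear_terms_le {x : ℝ} (hx : x ∈ Icc (-a) a) (K : ℝ) :
    Real.exp (x / 2) * (a + x + K) + Real.exp (-(x / 2)) * (a - x + K)
      ≤ (2 * a + K) * (Real.exp (x / 2) + Real.exp (-(x / 2))) := by
  have hE : 0 < Real.exp (x / 2) := Real.exp_pos _
  have hE' : 0 < Real.exp (-(x / 2)) := Real.exp_pos _
  have hxa : |x| ≤ a := abs_le.2 ⟨hx.1, hx.2⟩
  have hodd : x * (Real.exp (x / 2) - Real.exp (-(x / 2))) ≤ a * (Real.exp (x / 2) + Real.exp (-(x / 2))) := by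
    have h2 : |Real.exp (x / 2) - Real.exp (-(x / 2))| ≤ Real.exp (x / 2) + Real.exp (-(x / 2)) :=
      abs_le.2 ⟨by linarith, by linarith⟩
    calc x * (Real.exp (x / 2) - Real.exp (-(x / 2))) ≤ |x| * |Real.exp (x / 2) - Real.exp (-(x / 2))| := by
          rw [← abs_mul]; exact le_abs_self _
      _ ≤ a * (Real.exp (x / 2) + Real.exp (-(x / 2))) := mul_le_mul hxa h2 (abs_nonneg _) ((abs_nonneg x).trans hxa)
  nlinarith [hodd]

/-- **Schur bound for the weight `cosh(x/2)` with Chebyshev's constant**: on `[−a, a]`,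
`½·[e^{x/2}(M(e^{a+x}) + ψ(e^{a−x})) + e^{−x/2}(ψ(e^{a+x}) + M(e^{a−x}))] ≤ (1.106·e^a + 12a² + 2a + 4039/50)·cosh(x/2)`. -/
theorem schurBound_cosh_chebyshev {x : ℝ} (hx : x ∈ Icc (-a) a) :
    (Real.exp (x / 2) * ((∑ n ∈ Finset.Ioc 0 ⌊Real.exp (a + x)⌋₊, (Λ n : ℝ) / n) + ψ (Real.exp (a - x)))
        + Real.exp (-(x / 2)) * (ψ (Real.exp (a + x)) + ∑ n ∈ Finset.Ioc 0 ⌊Real.exp (a - x)⌋₊, (Λ n : ℝ) / n)) / 2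
      ≤ (1106 / 1000 * Real.exp a + 12 * a ^ 2 + 2 * a + 4039 / 50) * Real.cosh (x / 2) := by
  have hp0 : 0 ≤ a + x := by linarith [hx.1]
  have hq0 : 0 ≤ a - x := by linarith [hx.2]
  have hp1 : 1 ≤ Real.exp (a + x) := Real.one_le_exp hp0
  have hq1 : 1 ≤ Real.exp (a - x) := Real.one_le_exp hq0
  have hMp := Literature.NumberTheory.LFunctions.MertensFirstUpper.sum_vonMangoldt_div_floor_le_log_add hp1
  have hMm := Literature.NumberTheory.LFunctions.MertensFirstUpper.sum_vonMangoldt_div_floor_le_log_add hq1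
  have hψp := psi_le_cheb hp1
  have hψm := psi_le_cheb hq1
  rw [Real.log_exp] at hMp hMm hψp hψm
  have hE : 0 < Real.exp (x / 2) := Real.exp_pos _
  have hE' : 0 < Real.exp (-(x / 2)) := Real.exp_pos _
  have hex1 : Real.exp (x / 2) * Real.exp (a - x) = Real.exp a * Real.exp (-(x / 2)) := by
    rw [← Real.exp_add, ← Real.exp_add]; ring_nf
  have hex2 : Real.exp (-(x / 2)) * Real.exp (a + x) = Real.exp a * Real.exp (x / 2) := by
    rw [← Real.exp_add, ← Real.exp_add]; ring_nf
  have hsqp : (a + x) ^ 2 ≤ 4 * a ^ 2 := by nlinarith [hx.1, hx.2]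
  have hsqm : (a - x) ^ 2 ≤ 4 * a ^ 2 := by nlinarith [hx.1, hx.2]
  have hlin := linear_terms_le hx (12 * a ^ 2 + 80 + 39 / 50)
  have hup : Real.exp (x / 2) * ((∑ n ∈ Finset.Ioc 0 ⌊Real.exp (a + x)⌋₊, (Λ n : ℝ) / n) + ψ (Real.exp (a - x)))
        + Real.exp (-(x / 2)) * (ψ (Real.exp (a + x)) + ∑ n ∈ Finset.Ioc 0 ⌊Real.exp (a - x)⌋₊, (Λ n : ℝ) / n)
      ≤ Real.exp (x / 2) * ((a + x + 39 / 50) + (1106 / 1000 * Real.exp (a - x) + 3 * (a - x) ^ 2 + 80))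
        + Real.exp (-(x / 2)) * ((1106 / 1000 * Real.exp (a + x) + 3 * (a + x) ^ 2 + 80) + (a - x + 39 / 50)) := by
    gcongr
  refine (div_le_div_of_nonneg_right hup (by norm_num : (0 : ℝ) ≤ 2)).trans ?_
  rw [Real.cosh_eq]
  have h3p : Real.exp (-(x / 2)) * (3 * (a + x) ^ 2) ≤ Real.exp (-(x / 2)) * (12 * a ^ 2) :=
    mul_le_mul_of_nonneg_left (by linarith) hE'.le
  have h3m : Real.exp (x / 2) * (3 * (a - x) ^ 2) ≤ Real.exp (x / 2) * (12 * a ^ 2) :=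
    mul_le_mul_of_nonneg_left (by linarith) hE.le
  nlinarith [hex1, hex2, hlin, h3p, h3m, Real.exp_pos a]

/-- **A far constant for every window from the Schur test** (any `N`, any `a`): for every real measurable bounded `f`
vanishing off `[−a, a]`, `Σ_{n<N} 2Λ(n)/√n ∫ f(x − log n) f(x) dx ≤ (1.106·e^a + 12a² + 2a + 4039/50) · ∫ f²`. -/
theorem shiftBound_range_chebyshev {N : ℕ} {f : ℝ → ℝ} {C : ℝ} (hf : Measurable f) (hC : ∀ x, |f x| ≤ C)
    (hsupp : ∀ x, x ∉ Icc (-a) a → f x = 0) :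
    ∑ n ∈ Finset.range N, 2 * ((Λ n : ℝ) / Real.sqrt n) * (∫ x, f (x - Real.log n) * f x)
      ≤ (1106 / 1000 * Real.exp a + 12 * a ^ 2 + 2 * a + 4039 / 50) * ∫ x, f x ^ 2 := by
  have hw : Measurable fun y : ℝ ↦ Real.cosh (y / 2) := Real.continuous_cosh.measurable.comp (measurable_id.div_const 2)
  refine shiftBound_range_of_schur hw (c := 1) (Cw := Real.cosh (a / 2)) one_pos (fun x _ ↦ Real.one_le_cosh _)
    (fun x hx ↦ Real.cosh_le_cosh.2 ?_) (fun x hx ↦ (schurSum_cosh_le hx _).trans (schurBound_cosh_chebyshev hx)) hf hC hsupp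
  rw [abs_div, abs_div, abs_two]
  exact div_le_div_of_nonneg_right ((abs_le.2 ⟨hx.1, hx.2⟩).trans (le_abs_self a)) (by norm_num)

/-- **The floor's exponential order from above, Chebyshev's constant**: for every `a > 0`,
`λ_max(a) ≤ (1106/1000)·e^a + 12a² + 2a + 4039/50`; with `WeilFarFloorGrowth` (`0.7e^a/a − 6 ≤ λ_max(a)`) the floor has exact
exponential order, and `limsup λ_max(a)e^{−a} ≤ 1.106` (the law C-XIII says `1`). -/
theorem farCoercivityFloor_le_chebyshev (ha : 0 < a) :
    farCoercivityFloor a ≤ 1106 / 1000 * Real.exp a + 12 * a ^ 2 + 2 * a + 4039 / 50 :=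
  farCoercivityFloor_le_of_rangeBound ha (N := ⌈Real.exp (2 * a)⌉₊) (Nat.le_ceil _)
    fun _ _ hf hC hsupp ↦ shiftBound_range_chebyshev hf hC hsupp

end FloorSchur

end Summit.RiemannHypothesis.RiemannHypothesis.Theorems.WeilFormatC
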